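import Literature.MathematicalPhysics.QuantumFieldTheory.Balaban1983to89.B9Eq340ProbeTransferSNY
import Literature.MathematicalPhysics.QuantumFieldTheory.Balaban1983to89.B9HolderProbesKAFromGradSrc
import Literature.MathematicalPhysics.QuantumFieldTheory.Balaban1983to89.Node00.OpsYNablaBridge

/-!
# `Balaban1983to89.B9Eq340ProbeBridgeSNtoKA` — T. Bałaban, *Propagators for lattice gauge theories in a background field*, Commun. Math. Phys. **99** (1985) 389–434
# [Balaban1985BackgroundPropagators], (3.43) p. 398 for `∇_UG′(U)` READ ON BONDS FROM ITS READING ON SITES: the (3.43) probe member of `Φ^X_β ∘ D_U ∘ G′` at the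
# certificate's BOND probe pin `holderProbesKA … parBY` (rows 20–21's `hpDGW`) from the (3.43) probe member of `Φ_β ∘ ∇_U ∘ G′` at the near SITE carrier
# `holderProbesSN … parSY` (rows 18's engine after `B9Eq340ProbeTransferSNY`) and the (3.42)₂ sup member — node00-def-Y's carrier bridge «`D_U` is `∇_U` read on bonds»
# (`Node00.OpsYNablaBridge.DvcoKH_GcoS_apply_eq`) for PROBES

[4] = T. Bałaban, *Propagators and renormalization transformations for lattice gauge theories. II*, Commun. Math. Phys. **96** (1984) 223–250 [`Balaban1984PropagatorsII`].
statement-level skeleton of published theorems with citation tags; proofs where landed; nothing here is a claim about the Yang–Mills mass gap.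

THE PRINT.  (3.3) p. 390–391 (*«(D_Uλ)(⟨x, x+ηe_μ⟩) = … = (D_{U,μ}λ)(x)»*: a bond function IS its site components); (3.40) p. 397 (the covariant quotient of a bond function
transports between the base points along `U(Γ_{x,x′})`); (3.42)₂ + (3.43)₁ pp. 397–398 (`|∇_UG′λ| ≦ B₀Lʲη…`, `‖ζ∇_UG′λ‖_β ≦ B₀(β)(Lʲη)^{1−β}…`); [4] (2.137) p. 247 (admissible pairs).

WHY THIS FILE (cell `pub-ymgap`, node N06 [B9], seat `pub-ymgap-dag-n06-c` g19; road R4 of the G′ Hölder layer of rows 20–21, dag-n06-d `DISPLAY-LEDGER-UF.md` §2 binder `hpDGW`).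
The displayed `hpDGW` is a majorant of `(𝔭A x).ΦX U β′ ∘ (𝔬12 x).Dv U ∘ GcoS … G′ U` from the site class `𝔠⁽⁰⁾_{blkW}` to the probe class `𝔠_P^{(β′−1)}_{blkPX}`, at the pins
`𝔭A x = holderProbesKA … parB (bI x)` (`parB = parBY`), `(𝔬12 x).Dv U = DvcoKH … U`, `(𝔬12 x).blkW = blkSK (sIK bI)`.  The engine of rows 18 (re-pinned to the near carrier
and transferred to `parSY` by `B9Eq340ProbeTransferSNY`) delivers the same majorant for `(holderProbesSN … parSY bI).ΦX U β′ ∘ DcoS … U ∘ GcoS … G′ U` on the SITE carrier.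
Since `parSY U z z′ = parBY U (chart⁻¹ z) (chart⁻¹ z′)`, `DvcoKH F (b, ν, c, c′) = (c_fη)·DcoS (slotCopyK ν F)(chart b₋, b.dir, c, c′)`, an admissible bond pair IS a near site
pair of the base points with the same weight, and the anchors agree for a direction-blind `bI`, every KA pair probe of `D_U G′ f` IS `(c_fη)` times an SN pair probe of
`∇_U G′ (slotCopyK ν f)`; the (transported) point probes are read off the sup member (dag-n06-l g27's `pointProbe_le_of_sup ∕ transProbe_le_of_sup`).
* §1 `wKA_eq_wSN_of_adm` (the two pair weights agree, `|c_f| = Lᵏ`), `nearS_chartY_of_adm` (admissible ⇒ near), `parSY_chartY` (`parSY` on charted base points IS `parBY`),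
  ★ `pairProbeKA_eq_mul_pairProbeSN` (the pair probe identity for `DvcoKH ∘ GcoS`), `ofBlocks_loc_slotCopyK_le` (slot copies do not grow the source size).
* §2 ★★★ `hasMaj_probesKA_DvGcoS_of_probesSN` — `HasMaj 𝔠⁽⁰⁾_{blkSK(sIK bI)} 𝔠_P^{(β−1)}_{blkPK(sIK bI)} (Φ_SN(parSY) β ∘ DcoS ∘ GcoS G′) (C_b e^{−δd})` +
  `HasMaj 𝔠⁽⁰⁾ 𝔠^{(−1)}_{blkSK(sIK bI)} (DcoS ∘ GcoS G′) (C₀ e^{−δd})` ⟹ `HasMaj 𝔠⁽⁰⁾_{blkSK(sIK bI)} 𝔠_P^{(β−1)}_{blkPK bI} (Φ_KA(parBY) β ∘ DvcoKH ∘ GcoS G′) ((|c_f|η)·(C_b + C₀ + c_b b_b C₀) e^{−δd})`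
  — the SHAPE of `hpDGW` at the pins, for every `β ≤ 1`, every `U` with unitary-like bond variables, every real basis.

HONEST SCOPE.  Finite-dimensional bookkeeping over def-Y's carrier bridge and n06-l's ∕ this seat's probe lemmas; the two input members are HYPOTHESES of printed shape; nothing of [B9]
asserted; no certificate edition written; COUNT-NEUTRAL; N06 NOT discharged; nothing continuum, nothing about the mass gap.  Cell `pub-ymgap` (HUMAN RULING D-0062), Track A node N06
[B9], seat `pub-ymgap-dag-n06-c` (g19), 2026-08-29; a NEW file; 0 `def`, no `sorry`, no `axiom`, no `instance`, no `notation`.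
-/

namespace Literature.MathematicalPhysics.QuantumFieldTheory.Balaban1983to89.B9Eq340ProbeBridgeSNtoKA

open LatticeFieldCalculus (supDist)
open B9Eq39Adjoint (R R_smul)
open B4TorusKernel.MultiPeriod (torusSupNorm torusSupNorm_nonneg)
open B9BackgroundsKLevelV1 (CfgV1)
open B6GlobalChartV1 (PV blkV1 domT boxEquiv)
open B6Geom246MultiLevelBox (blkOf)
open B6Ineq2142KLevelV1 (β lvl)
open B6KLevelCensusIndexV1 (KIdx Adm kGeo len_eq)
open B6Geom246MultiLevelTorus (geomT torusSupNorm_neg)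
open B6MultiLevelTorusOperator (one_le_of_mem)
open B6Prop22KLevelTorusCensusEta (nKT nKT_pos)
open B9Thm34Ext (toB6)
open B9GeoNormsKLevelV1 (geo9K)
open B9GeoLemma21KLevelV1 (geo9K_len_pos)
open B9Thm39ReadingCoords (coordBound39 basisBound39 abs_repr_le)
open B9CoReadingCoords (assembleK XBK blkBK)
open B9CoReadingCoordsS (XSK blkSK sIK blkV1_site GcoS DcoS)
open Node00.OpsYSectDCoords (DvcoKH)
open B9CoReadingCoordsHolder (PK blkPK probeK probeK_inl probeK_inr_inl probeK_inr_inr wK w₀K wK_nonneg w₀K_nonneg holderProbesK)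
open B9CoReadingCoordsHolderAdm (wKA wKA_of_adm holderProbesKA ΦX_KA_inl_of_adm ΦX_KA_inl_of_not_adm ΦX_KA_inr_inl ΦX_KA_inr_inr)
open B9CoReadingCoordsHolderS (wS wS_nonneg)
open B9CoReadingCoordsHolderSNear (NearS wSN wSN_of_near wSN_nonneg holderProbesSN ΦX_SN_eq)
open Node00 (SiteY FBondY IBondY CfgY SiteOpY SiteParY BondParY parSY parBY parTaxiV toKT levY etaS)
open Node00.OpsYHolderFar (pdist)
open Node00.OpsYNablaBridge (chartY slotCopyK slotCopyK_apply DvcoKH_GcoS_apply_eq assembleK_slotCopyK)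
open B9Ineq349SiteComposite (etaS_pos)
open B9Eq340TaxiTelescope (norm_R_le)
open B9Thm33G0ProbeZeroAtPinsAdm (norm_assembleK_le unitaryLike_parTaxiV w₀K_eq_len_rpow)
open B9HolderProbesKAFromGradSrc (pointProbe_le_of_sup transProbe_le_of_sup)
open B9Eq340TransporterChangeY (supDist_symm_le_torusSupNorm)
open B6HolderPairPlacementV1 (torusSupNorm_toBox_sub_le_supDist)
open T4RelativeLadder (UnitaryLike)
open B9Thm312Whole (GeoOK)
open B9Thm312WholeClasses (cNormR cNormR_loc cNormR_isLoc)
open B9SmoothHolderClassTClosure (abs_apply_le_of_hasMaj_cNormR len_le_one)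
open B11SectG (BlockNorm HasMaj)

noncomputable section

variable {d ℓ : ℕ} {hd : 1 ≤ d + 1} {hL : Odd (ℓ + 1) ∧ 1 < ℓ + 1} {b₀ b₁ : ℝ}
variable {𝔸 : Type} [NormedRing 𝔸] [NormedAlgebra ℂ 𝔸] [CompleteSpace 𝔸]
variable {κ : Type} [Fintype κ] [DecidableEq κ]

/-! ## §1 Admissible bond pairs are near site pairs with the same weight; the pair probe identity -/

section Pointwise

variable (i : KIdx d ℓ hd hL b₀ b₁)

omit [CompleteSpace 𝔸] in
/-- the charted sup-distance IS print's torus distance: `|x − x′|_∞ = |chart x′ − chart x|_T`. [cite: Balaban1984PropagatorsII, (2.1) p.224 (T_η), dictionary] -/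
theorem supDist_eq_torusSupNorm (x x' : Site (PV d ℓ i.m i.K hd hL) 0) :
    (supDist x x' : ℝ) = torusSupNorm (toKT i).NB ((chartY i x').1 - (chartY i x).1) := by
  apply le_antisymm
  · have h := supDist_symm_le_torusSupNorm i (chartY i x') (chartY i x)
    have e1 : (boxEquiv i.hN).symm (chartY i x) = x := (boxEquiv i.hN).symm_apply_apply x
    have e2 : (boxEquiv i.hN).symm (chartY i x') = x' := (boxEquiv i.hN).symm_apply_apply x'
    rw [e1, e2] at h
    exact h
  · have h : torusSupNorm (toKT i).NB ((chartY i x').1 - (chartY i x).1) ≤ (supDist x' x : ℝ) :=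
      torusSupNorm_toBox_sub_le_supDist i.hN x' x
    rw [B3TorusRadialSums.supDist_comm] at h
    exact h

omit [CompleteSpace 𝔸] in
/-- ★ **AN ADMISSIBLE BOND PAIR IS A NEAR SITE PAIR** of its base points: `Adm x x′` ⇒ `NearS (chart x₋) (chart x′₋)` (the bond block of `x` is the block of `x₋`).
[cite: Balaban1984PropagatorsII, (2.137) p.247; Balaban1985BackgroundPropagators, (3.40) p.397] -/
theorem nearS_chartY_of_adm {x x' : FBondY i} (h : Adm i x x') : NearS i (chartY i x.src) (chartY i x'.src) := by
  unfold NearS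
  rw [← neg_sub, torusSupNorm_neg (fun μ => one_le_of_mem (chartY i x.src).2 μ), ← supDist_eq_torusSupNorm i x.src x'.src]
  have h2 : (supDist x.src x'.src : ℝ) ≤ (((ℓ + 1) ^ (blkV1 i.hN i.D x).1.1 : ℕ) : ℝ) := by exact_mod_cast h.2.1
  refine h2.trans (le_of_eq ?_)
  push_cast
  congr 1

omit [CompleteSpace 𝔸] in
/-- ★ **THE TWO PAIR WEIGHTS AGREE** (`|c_f| = Lᵏ`): on an admissible pair `wKA β x x′ = wSN β (chart x₋) (chart x′₋)`.
[cite: Balaban1985BackgroundPropagators, (3.40) p.397, dictionary] -/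
theorem wKA_eq_wSN_of_adm (hcf : |i.cf| = (nKT (toKT i) : ℝ)) (βh : ℝ) {x x' : FBondY i} (h : Adm i x x') :
    wKA i βh x x' = wSN i βh (chartY i x.src) (chartY i x'.src) := by
  rw [wKA_of_adm i βh h, wSN_of_near i βh (nearS_chartY_of_adm i h), wK, wS, supDist_eq_torusSupNorm i x.src x'.src, hcf, ← div_eq_mul_inv,
    Real.rpow_neg (div_nonneg (torusSupNorm_nonneg (fun μ => one_le_of_mem (chartY i x.src).2 μ) _) (Nat.cast_nonneg _))]

/-- `parSY` on charted base points IS def-Y's bond transporter `parBY`. [cite: Balaban1985BackgroundPropagators, (3.40) p.397, dictionary] -/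
theorem parSY_chartY (U : CfgY 𝔸 i) (x x' : Site (PV d ℓ i.m i.K hd hL) 0) :
    parSY i U (chartY i x) (chartY i x') = parBY i U x x' := by
  have e1 : (boxEquiv i.hN).symm (chartY i x) = x := (boxEquiv i.hN).symm_apply_apply x
  have e2 : (boxEquiv i.hN).symm (chartY i x') = x' := (boxEquiv i.hN).symm_apply_apply x'
  show parTaxiV U ((boxEquiv i.hN).symm (chartY i x)) ((boxEquiv i.hN).symm (chartY i x')) = parTaxiV U x x'
  rw [e1, e2]

variable (b : Module.Basis κ ℝ 𝔸) [FiniteDimensional ℝ 𝔸] {B : B9.Backgrounds} (cfg : B.Cfg → CfgY 𝔸 i) (O : SiteOpY 𝔸 i) (U₁ : B.Cfg)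
  {bI : FBondY i → IBondY i}

omit [DecidableEq κ] in
/-- on an admissible pair, the two bonds have the same direction, so both bond values assemble from the SAME slot of the slot-copied site reading.
[cite: Balaban1985BackgroundPropagators, (3.3) p.391, bookkeeping] -/
theorem assembleK_DvcoKH_GcoS (f : XSK κ i → ℝ) (x : FBondY i) (ν : Fin (d + 1)) (c' : κ) :
    assembleK b ν c' ((DvcoKH i b B cfg U₁ ∘ₗ GcoS i b B cfg O U₁) f) x =
      (i.cf * etaS i) • assembleK b x.dir c' ((DcoS i b B cfg U₁ ∘ₗ GcoS i b B cfg O U₁) (slotCopyK ν f)) (chartY i x.src) := by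
  unfold assembleK
  rw [Finset.smul_sum]
  refine Finset.sum_congr rfl fun a _ => ?_
  rw [DvcoKH_GcoS_apply_eq, smul_smul]

omit [DecidableEq κ] in
/-- ★ **THE PAIR PROBE IDENTITY**: on an admissible bond pair, the KA pair probe of `D_U G′ f` along `parBY` IS `(c_fη)` times the SN pair probe of `∇_U G′ (slotCopyK ν f)` along
`parSY` at the charted base points (same transporter, same weight, same slot = the common direction). [cite: Balaban1985BackgroundPropagators, (3.3) p.391 + (3.40) p.397 + (3.43) p.398] -/
theorem pairProbeKA_eq_mul_pairProbeSN (hcf : |i.cf| = (nKT (toKT i) : ℝ)) (βh : ℝ) (f : XSK κ i → ℝ) {x x' : FBondY i} (h : Adm i x x')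
    (ν : Fin (d + 1)) (c c' : κ) :
    (holderProbesKA i b B cfg (parBY i) bI).ΦX U₁ βh ((DvcoKH i b B cfg U₁ ∘ₗ GcoS i b B cfg O U₁) f) (Sum.inl ((x, x'), ν, c, c')) =
      (i.cf * etaS i) * (holderProbesSN i b B cfg (parSY i) bI).ΦX U₁ βh ((DcoS i b B cfg U₁ ∘ₗ GcoS i b B cfg O U₁) (slotCopyK ν f))
        (Sum.inl ((chartY i x.src, chartY i x'.src), x.dir, c, c')) := by
  rw [ΦX_KA_inl_of_adm i b B cfg (parBY i) U₁ βh _ h ν c c',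
    show (holderProbesK i b B cfg (parBY i) bI).ΦX U₁ βh = probeK b (fun x x' : FBondY i => parBY i (cfg U₁) x.src x'.src) (wK i βh) (w₀K i βh) from rfl,
    probeK_inl, ΦX_SN_eq, probeK_inl]
  dsimp only
  rw [assembleK_DvcoKH_GcoS, assembleK_DvcoKH_GcoS, ← h.1, R_smul, ← smul_sub, map_smul, Finsupp.smul_apply, smul_eq_mul, parSY_chartY,
    ← wKA_of_adm i βh h, wKA_eq_wSN_of_adm i hcf βh h]
  ring

/-- a value on the block is below the sharp-block sup. [folklore] -/
private theorem abs_le_ofBlocks_loc [Fintype (geo9K i).Site] {X : Type} [Fintype X] {R₀ : ℝ} {H₀ : Prop} (blk : X → IBondY i) {y : IBondY i} (f : X → ℝ) {x : X} (hx : blk x = y) :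
    |f x| ≤ (BlockNorm.ofBlocks (toB6 (geo9K i) R₀ H₀) blk).loc y f := by
  classical
  show |f x| ≤ ⨆ x : X, @ite ℝ (blk x = y) (Classical.propDecidable _) |f x| 0
  refine le_trans ?_ (le_ciSup (Finite.bddAbove_range _) x)
  rw [if_pos hx]

/-- the sharp-block sup of `f` at `y` is below any `M ≥ 0` bounding `|f|` on the block. [folklore] -/
private theorem ofBlocks_loc_le_of_forall [Fintype (geo9K i).Site] {X : Type} [Fintype X] {R₀ : ℝ} {H₀ : Prop} (blk : X → IBondY i) {y : IBondY i}
    {f : X → ℝ} {M : ℝ} (hM : 0 ≤ M) (h : ∀ x, blk x = y → |f x| ≤ M) : (BlockNorm.ofBlocks (toB6 (geo9K i) R₀ H₀) blk).loc y f ≤ M := by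
  classical
  show (⨆ x : X, @ite ℝ (blk x = y) (Classical.propDecidable _) |f x| 0) ≤ M
  refine Real.iSup_le (fun x => ?_) hM
  split_ifs with hx
  · exact h x hx
  · exact hM

omit [DecidableEq κ] in
/-- ★ slot copies do not grow the source size: `loc_{y}(slotCopyK ν f) ≤ loc_{y}(f)` for the sharp sup over the (slot-blind) site anchors.
[cite: Balaban1985BackgroundPropagators, (3.42) p.397 («|λ|»), bookkeeping] -/
theorem ofBlocks_loc_slotCopyK_le [Fintype (geo9K i).Site] {R₀ : ℝ} {H₀ : Prop} (y : IBondY i) (f : XSK κ i → ℝ) (ν : Fin (d + 1)) :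
    (BlockNorm.ofBlocks (toB6 (geo9K i) R₀ H₀) (blkSK i (sIK i bI))).loc y (slotCopyK ν f) ≤
      (BlockNorm.ofBlocks (toB6 (geo9K i) R₀ H₀) (blkSK i (sIK i bI))).loc y f := by
  refine ofBlocks_loc_le_of_forall i (blkSK i (sIK i bI)) ((BlockNorm.ofBlocks (toB6 (geo9K i) R₀ H₀) (blkSK i (sIK i bI))).loc_nonneg y f) ?_
  rintro ⟨z, μ, a, c⟩ hq
  rw [slotCopyK_apply]
  exact abs_le_ofBlocks_loc i (blkSK i (sIK i bI)) f (x := (z, ν, a, c)) hq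

end Pointwise

/-! ## §2 ★★★ The bond probe member of `D_U ∘ G′` from the site probe member of `∇_U ∘ G′` and the sup member -/

section Package

variable (i : KIdx d ℓ hd hL b₀ b₁) (b : Module.Basis κ ℝ 𝔸) [FiniteDimensional ℝ 𝔸] [Fintype (geo9K i).Site]
variable {B : B9.Backgrounds} (cfg : B.Cfg → CfgY 𝔸 i) (O : SiteOpY 𝔸 i) (U₁ : B.Cfg) {bI : FBondY i → IBondY i}
variable {R₀ : ℝ} {H₀ : Prop}

omit [DecidableEq κ] in
/-- ★★★ **`hpDGW`'s SHAPE FROM THE SITE SIDE.**  For unitary-like bond variables, a direction-blind, level-faithful bond block map `bI` (`hbI0 hlev`), print's units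
`|c_f| = Lᵏ` and `β ≤ 1`: if the SITE probe family of `∇_U ∘ G′` along `parSY` is bounded `𝔠⁽⁰⁾_{blkSK(sIK bI)} → 𝔠_P^{(β−1)}_{blkPK(sIK bI)}` by `C_b e^{−δd}` ((3.43)₁ on sites) and
`∇_U ∘ G′` is bounded `𝔠⁽⁰⁾ → 𝔠^{(−1)}` by `C₀ e^{−δd}` ((3.42)₂), then the BOND probe family of `D_U ∘ G′` along `parBY` (the certificate's `(𝔭A x).ΦX ∘ (𝔬12 x).Dv ∘ GcoS G′` at the
pins) is bounded `𝔠⁽⁰⁾_{blkSK(sIK bI)} → 𝔠_P^{(β−1)}_{blkPK bI}` by `(|c_f|η)·(C_b + C₀ + c_b b_b C₀)·e^{−δd}` (`|c_f|η = 1` at members).  Pair probes: `0` off `Adm`; on `Adm`, §1's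
identity + the site member on the slot copy (same anchor by `hbI0`, source size not grown); (transported) point probes: dag-n06-l g27's `pointProbe_le_of_sup ∕ transProbe_le_of_sup`
on the bond values `|D_UG′f| = (|c_f|η)·|∇_UG′(slotCopy f)| ≤ (|c_f|η)C₀·len·e^{−δd}·‖f‖`.
[cite: Balaban1985BackgroundPropagators, (3.3) p.391 + (3.40) p.397 + (3.42)–(3.43) pp.397–398; Balaban1984PropagatorsII, (2.51)–(2.52) p.232, (2.137) p.247] -/
theorem hasMaj_probesKA_DvGcoS_of_probesSN [NormOneClass 𝔸] (hG : GeoOK (geo9K i)) (hU : ∀ μ s, UnitaryLike (cfg U₁ μ s))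
    (hlev : ∀ x : FBondY i, lvl i.hN i.D i.hk (bI x) = (blkV1 i.hN i.D x).1.1) (hbI0 : ∀ x : FBondY i, bI x = bI ⟨x.src, 0⟩)
    (hcf : |i.cf| = (nKT (toKT i) : ℝ)) {βh : ℝ} {C₀ Cb δ : ℝ} (hC₀ : 0 ≤ C₀) (hCb : 0 ≤ Cb)
    (hpr : HasMaj (cNormR R₀ H₀ (blkSK i (sIK i bI)) hG.lenle 0) (cNormR R₀ H₀ (blkPK (sIK i bI)) hG.lenle (βh - 1))
      ((holderProbesSN i b B cfg (parSY i) bI).ΦX U₁ βh ∘ₗ (DcoS i b B cfg U₁ ∘ₗ GcoS i b B cfg O U₁))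
      (fun a a' => Cb * Real.exp (-(δ * (geo9K i).dist a a'))))
    (hsup : HasMaj (cNormR R₀ H₀ (blkSK i (sIK i bI)) hG.lenle 0) (cNormR R₀ H₀ (blkSK i (sIK i bI)) hG.lenle (-1))
      (DcoS i b B cfg U₁ ∘ₗ GcoS i b B cfg O U₁) (fun a a' => C₀ * Real.exp (-(δ * (geo9K i).dist a a')))) :
    HasMaj (cNormR R₀ H₀ (blkSK i (sIK i bI)) hG.lenle 0) (cNormR R₀ H₀ (blkPK bI) hG.lenle (βh - 1))
      ((holderProbesKA i b B cfg (parBY i) bI).ΦX U₁ βh ∘ₗ (DvcoKH i b B cfg U₁ ∘ₗ GcoS i b B cfg O U₁))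
      (fun a a' => (|i.cf| * etaS i) * (Cb + C₀ + coordBound39 b * basisBound39 b * C₀) * Real.exp (-(δ * (geo9K i).dist a a'))) := by
  classical
  set γ : ℝ := |i.cf| * etaS i with hγ
  have hγ0 : 0 ≤ γ := mul_nonneg (abs_nonneg _) (etaS_pos i).le
  have hcB : 0 ≤ coordBound39 b := by unfold coordBound39; exact norm_nonneg _
  have hbB : 0 ≤ basisBound39 b := Finset.sum_nonneg fun _ _ => norm_nonneg _
  set Ctot : ℝ := γ * (Cb + C₀ + coordBound39 b * basisBound39 b * C₀) with hCtot
  have hCtot0 : 0 ≤ Ctot := by rw [hCtot]; positivity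
  intro y' f hf y
  -- the source: `f` vanishes off the site block `y′`; its size and the size of its slot copies
  set M : ℝ := (cNormR R₀ H₀ (blkSK i (sIK i bI)) hG.lenle 0).loc y' f with hMdef
  have hM : 0 ≤ M := (cNormR R₀ H₀ (blkSK i (sIK i bI)) hG.lenle 0).loc_nonneg _ _
  have hfS : ∀ ν : Fin (d + 1), (cNormR R₀ H₀ (blkSK i (sIK i bI)) hG.lenle 0).IsLoc y' (slotCopyK ν f) := by
    intro ν q hq
    rw [cNormR_isLoc] at hf
    obtain ⟨z, μ, a, c⟩ := q
    rw [slotCopyK_apply]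
    exact hf (z, ν, a, c) hq
  have hMS : ∀ ν : Fin (d + 1), (cNormR R₀ H₀ (blkSK i (sIK i bI)) hG.lenle 0).loc y' (slotCopyK ν f) ≤ M := by
    intro ν
    rw [hMdef, cNormR_loc, cNormR_loc]
    exact mul_le_mul_of_nonneg_left (ofBlocks_loc_slotCopyK_le i y' f ν) (Real.rpow_nonneg (le_of_lt (geo9K_len_pos i y')) _)
  -- the site anchor of a bond's base point IS the bond's block (direction-blind `bI`)
  have hanchor : ∀ x : FBondY i, sIK i bI (chartY i x.src) = bI x := by
    intro x
    show bI ⟨(boxEquiv i.hN).symm (boxEquiv i.hN x.src), 0⟩ = bI x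
    rw [Equiv.symm_apply_apply, ← hbI0 x]
  -- the bond values of `D_U G′ f` from the sup member on the slot copies
  set G : XBK κ i → ℝ := (DvcoKH i b B cfg U₁ ∘ₗ GcoS i b B cfg O U₁) f with hGdef
  have hF0 : ∀ q : XBK κ i, |G q| ≤ γ * C₀ * (geo9K i).len (bI q.1) * Real.exp (-(δ * (geo9K i).dist (bI q.1) y')) * M := by
    rintro ⟨x, ν, c, c'⟩
    rw [hGdef, DvcoKH_GcoS_apply_eq, abs_mul]
    have hv := abs_apply_le_of_hasMaj_cNormR i hG.lenle hsup (hfS ν) (chartY i x.src, x.dir, c, c')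
    have hl : 0 < (geo9K i).len (sIK i bI (chartY i x.src)) := geo9K_len_pos i _
    rw [show blkSK i (sIK i bI) (chartY i x.src, x.dir, c, c') = sIK i bI (chartY i x.src) from rfl, Real.rpow_neg hl.le, inv_inv, Real.rpow_one,
      hanchor x] at hv
    have habs : |i.cf * etaS i| = γ := by rw [hγ, abs_mul, abs_of_pos (etaS_pos i)]
    rw [habs]
    calc γ * |(DcoS i b B cfg U₁ ∘ₗ GcoS i b B cfg O U₁) (slotCopyK ν f) (chartY i x.src, x.dir, c, c')|
        ≤ γ * ((geo9K i).len (bI x) * (C₀ * Real.exp (-(δ * (geo9K i).dist (bI x) y'))) * (cNormR R₀ H₀ (blkSK i (sIK i bI)) hG.lenle 0).loc y' (slotCopyK ν f)) :=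
          mul_le_mul_of_nonneg_left hv hγ0
      _ ≤ γ * ((geo9K i).len (bI x) * (C₀ * Real.exp (-(δ * (geo9K i).dist (bI x) y'))) * M) := by
          refine mul_le_mul_of_nonneg_left (mul_le_mul_of_nonneg_left (hMS ν) ?_) hγ0
          have := geo9K_len_pos i (bI x); positivity
      _ = γ * C₀ * (geo9K i).len (bI x) * Real.exp (-(δ * (geo9K i).dist (bI x) y')) * M := by ring
  -- every probe anchored at `y` is `≤ Ctot·len(y)^{1−β}·e^{−δ d(y,y′)}·M`
  have hpt : ∀ idx : PK (FBondY i) (Fin (d + 1)) κ, blkPK bI idx = y →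
      |(holderProbesKA i b B cfg (parBY i) bI).ΦX U₁ βh G idx| ≤
        Ctot * (geo9K i).len y ^ (1 - βh) * Real.exp (-(δ * (geo9K i).dist y y')) * M := by
    intro idx hidx
    have hup : ∀ {C a : ℝ} (z : IBondY i), C ≤ Ctot →
        a ≤ C * (geo9K i).len z ^ (1 - βh) * Real.exp (-(δ * (geo9K i).dist z y')) * M →
        a ≤ Ctot * (geo9K i).len z ^ (1 - βh) * Real.exp (-(δ * (geo9K i).dist z y')) * M := by
      intro C a z hCle h
      refine h.trans ?_
      have hl : 0 ≤ (geo9K i).len z ^ (1 - βh) := Real.rpow_nonneg (le_of_lt (geo9K_len_pos i z)) _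
      have hE := Real.exp_nonneg (-(δ * (geo9K i).dist z y'))
      exact mul_le_mul_of_nonneg_right (mul_le_mul_of_nonneg_right (mul_le_mul_of_nonneg_right hCle hl) hE) hM
    rcases idx with ⟨⟨x, x'⟩, ν, c, c'⟩ | ⟨⟨x, x'⟩, ν, c, c'⟩ | ⟨x, ν, c, c'⟩
    · have hx : bI x = y := hidx
      subst hx
      by_cases hadm : Adm i x x'
      · -- the pair probe identity + the site probe member on the slot copy
        rw [hGdef, pairProbeKA_eq_mul_pairProbeSN i b cfg O U₁ hcf βh f hadm ν c c', abs_mul]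
        have hv := abs_apply_le_of_hasMaj_cNormR i hG.lenle hpr (hfS ν) (Sum.inl ((chartY i x.src, chartY i x'.src), x.dir, c, c'))
        rw [LinearMap.comp_apply,
          show blkPK (I := (geo9K i).Site) (sIK i bI) (Sum.inl ((chartY i x.src, chartY i x'.src), x.dir, c, c') : PK (SiteY i) (Fin (d + 1)) κ) = bI x
            from hanchor x] at hv
        have hl : 0 < (geo9K i).len (bI x) := geo9K_len_pos i _
        have habs : |i.cf * etaS i| = γ := by rw [hγ, abs_mul, abs_of_pos (etaS_pos i)]
        rw [habs]
        have e : ((geo9K i).len (bI x) ^ (βh - 1))⁻¹ = (geo9K i).len (bI x) ^ (1 - βh) := by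
          rw [← Real.rpow_neg hl.le, neg_sub]
        have h1 : γ * |((holderProbesSN i b B cfg (parSY i) bI).ΦX U₁ βh) ((DcoS i b B cfg U₁ ∘ₗ GcoS i b B cfg O U₁) (slotCopyK ν f))
              (Sum.inl ((chartY i x.src, chartY i x'.src), x.dir, c, c'))| ≤
            γ * Cb * (geo9K i).len (bI x) ^ (1 - βh) * Real.exp (-(δ * (geo9K i).dist (bI x) y')) * M := by
          calc _ ≤ γ * (((geo9K i).len (bI x) ^ (βh - 1))⁻¹ * (Cb * Real.exp (-(δ * (geo9K i).dist (bI x) y'))) *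
                  (cNormR R₀ H₀ (blkSK i (sIK i bI)) hG.lenle 0).loc y' (slotCopyK ν f)) := mul_le_mul_of_nonneg_left hv hγ0
            _ ≤ γ * (((geo9K i).len (bI x) ^ (βh - 1))⁻¹ * (Cb * Real.exp (-(δ * (geo9K i).dist (bI x) y'))) * M) := by
                refine mul_le_mul_of_nonneg_left (mul_le_mul_of_nonneg_left (hMS ν) ?_) hγ0
                rw [e]; have := Real.rpow_nonneg hl.le (1 - βh); positivity
            _ = γ * Cb * (geo9K i).len (bI x) ^ (1 - βh) * Real.exp (-(δ * (geo9K i).dist (bI x) y')) * M := by rw [e]; ring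
        exact hup (C := γ * Cb) (bI x) (by rw [hCtot]; nlinarith [mul_nonneg hγ0 hC₀, mul_nonneg hγ0 (mul_nonneg (mul_nonneg hcB hbB) hC₀)]) h1
      · rw [ΦX_KA_inl_of_not_adm i b B cfg (parBY i) U₁ βh G hadm ν c c', abs_zero]
        have hl : 0 ≤ (geo9K i).len (bI x) ^ (1 - βh) := Real.rpow_nonneg (le_of_lt (geo9K_len_pos i (bI x))) _
        have hE := Real.exp_nonneg (-(δ * (geo9K i).dist (bI x) y'))
        positivity
    · have hx : bI x' = y := hidx
      subst hx
      rw [ΦX_KA_inr_inl]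
      have h := transProbe_le_of_sup i b cfg U₁ (par := parBY i) rfl hU hlev G (C₀ := γ * C₀) hF0 βh x x' ν c c'
      exact hup (C := coordBound39 b * basisBound39 b * (γ * C₀)) (bI x')
        (by rw [hCtot]; nlinarith [mul_nonneg hγ0 hC₀, mul_nonneg hγ0 hCb]) h
    · have hx : bI x = y := hidx
      subst hx
      rw [ΦX_KA_inr_inr]
      exact hup (C := γ * C₀) (bI x) (by rw [hCtot]; nlinarith [mul_nonneg hγ0 hCb, mul_nonneg hγ0 (mul_nonneg (mul_nonneg hcB hbB) hC₀)])
        (pointProbe_le_of_sup i b cfg U₁ (parBY i) hlev G hF0 βh x ν c c')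
  -- assemble the `𝔠_P^{(β−1)}` size at `y`
  have hlen0 : 0 < (geo9K i).len y := geo9K_len_pos i y
  have hloc : (BlockNorm.ofBlocks (toB6 (geo9K i) R₀ H₀) (blkPK bI)).loc y
      (((holderProbesKA i b B cfg (parBY i) bI).ΦX U₁ βh ∘ₗ (DvcoKH i b B cfg U₁ ∘ₗ GcoS i b B cfg O U₁)) f) ≤
      Ctot * (geo9K i).len y ^ (1 - βh) * Real.exp (-(δ * (geo9K i).dist y y')) * M :=
    ofBlocks_loc_le_of_forall i (blkPK bI) (by positivity) hpt
  show (cNormR R₀ H₀ (blkPK bI) hG.lenle (βh - 1)).loc y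
      (((holderProbesKA i b B cfg (parBY i) bI).ΦX U₁ βh ∘ₗ (DvcoKH i b B cfg U₁ ∘ₗ GcoS i b B cfg O U₁)) f) ≤
    γ * (Cb + C₀ + coordBound39 b * basisBound39 b * C₀) * Real.exp (-(δ * (geo9K i).dist y y')) * M
  rw [cNormR_loc, ← hCtot]
  calc (geo9K i).len y ^ (βh - 1) * (BlockNorm.ofBlocks (toB6 (geo9K i) R₀ H₀) (blkPK bI)).loc y
        (((holderProbesKA i b B cfg (parBY i) bI).ΦX U₁ βh ∘ₗ (DvcoKH i b B cfg U₁ ∘ₗ GcoS i b B cfg O U₁)) f)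
      ≤ (geo9K i).len y ^ (βh - 1) * (Ctot * (geo9K i).len y ^ (1 - βh) * Real.exp (-(δ * (geo9K i).dist y y')) * M) :=
        mul_le_mul_of_nonneg_left hloc (Real.rpow_nonneg hlen0.le _)
    _ = Ctot * ((geo9K i).len y ^ (βh - 1) * (geo9K i).len y ^ (1 - βh)) * Real.exp (-(δ * (geo9K i).dist y y')) * M := by ring
    _ = Ctot * Real.exp (-(δ * (geo9K i).dist y y')) * M := by
        rw [← Real.rpow_add hlen0, show βh - 1 + (1 - βh) = 0 by ring, Real.rpow_zero, mul_one]

end Package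

end

end Literature.MathematicalPhysics.QuantumFieldTheory.Balaban1983to89.B9Eq340ProbeBridgeSNtoKA
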